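import Literature.Probability.Percolation.InterfaceLoopPolygon
import Literature.Probability.Percolation.HexLatticeSegments
import Literature.Probability.Percolation.TriAnnulusArms
import Literature.Probability.RandomPlanarGeometry.CurveTortuosity
import Literature.Topology.PlaneTopology.AnnulusArcs
import HarnessLib

/-!
# Multiple shell traversals by an interface loop of critical site percolation force many disjoint open arms

Topic: Probability / Percolation. Hypothesis H1 of M. Aizenman, A. Burchard, *Hölder regularity
and dimension bounds for random curves*, Duke Math. J. 99 (1999), eq. (1.3), for the **loop
ensemble** of critical site percolation on `δ𝕋` with closed (monochromatic) boundary condition —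
the system of all interface loops `IsSiteInterfaceLoop (ω ∩ M) w` (`CLE6.lean`) — in the form
consumed by the set version of the Aizenman–Burchard tightness criterion
(`LoopSpace.isTightLaws_map_of_traversalBounds`, `CurveSystemTightness.lean`): there are a
threshold `k`, `K ≥ 0` and `λ > 2` such that for every restriction set `M`, mesh `δ ∈ (0, 1]` and
shell `δ ≤ ρ < R ≤ 1`,
`P_{1/2}(some interface loop of ω ∩ M traverses D(x; ρ, R) k times) ≤ K (ρ/R)^λ`
(`triSitePercolation_exists_loop_hasTraversals_le`). AB99, Appendix A: "the `k` crossing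
segments cut the annulus into sectors … RSW … van den Berg–Kesten".

**The argument** (deterministic part, `mem_disjointOccurrencePow_of_hasTraversals`). Let the
polygon `Γ` of an interface loop (a simple closed curve, `toCurve_injOn_of_isCycle`) traverse
`D(x; ρ, R)` `2j + 3` times. Dropping the first traversal, each of the remaining `2j + 2`
contains a *strict tight crossing* of the shell `q₁ ≤ |z - x| ≤ q₂` (`ρ ≤ q₁ < q₂ ≤ R`): an arc of
`Γ` in the closed annulus meeting each boundary circle in one endpoint only; these arcs are
pairwise disjoint. To the `l`-th arc attach the component `S_l`, in the open annulus minus the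
trace of `Γ`, of the (open) left hexagon of a dart in the middle of the arc; `S_l` touches the
arc at the midpoint of that dart (located on the arc by the intermediate value theorem for the
side functional of the crossed edge), so by the three-arcs lemma `not_three_arcs_touch`
(`AnnulusArcs.lean`; winding numbers, no Jordan curve theorem) no three of the `S_l` coincide:
at least `j + 1` of them are distinct. The left sites along the middle part of each arc form an
open chain of `ω` crossing `A(x; q₁ + 9δ, q₂ - 9δ)` whose mesh points lie in `S_l`; chains with
distinct `S_l` are disjoint, so `ω ∈ (triArm δ x (q₁ + 9δ) (q₂ - 9δ))^{□ j}`
(`mem_disjointOccurrencePow_triArm_of_chains`). With the **closed boundary condition the left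
sites are open sites of `ω` itself** (the boundary only ever supplies closed sites), so — unlike
for the exploration path in a Dobrushin domain — no boundary bookkeeping is needed and the
threshold is an absolute constant. The probabilistic part is the iterated van den Berg–Kesten
inequality (`real_disjointOccurrencePow_le_pow`) and the Bollobás–Riordan annulus bound
(`real_triArm_le`, from `tri_annulusCrossing_bound_holds`).

Everything is proved; no named facts are introduced.

## References

* M. Aizenman, A. Burchard, Duke Math. J. 99 (1999), §1 (H1, eq. (1.3)) and Appendix A
  [AizenmanBurchardDuke1999].
* F. Camia, C. M. Newman, *SLE₆ and CLE₆ from critical percolation*, MSRI Publ. 55 (2008), §5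
  (tightness of the loop collections "follows directly from [AB]") [CamiaNewman2008].
* B. Bollobás, O. Riordan, *Percolation* (2006), Ch. 7 Lemma 4 (annulus crossings).
-/

noncomputable section

open Set Metric Complex Filter MeasureTheory
open Literature.Topology.PlaneTopology Literature.Probability.RandomPlanarGeometry
open scoped unitInterval Topology

namespace Literature.Probability.Percolation

open LatticeModels

/-! ### Strict tight crossings of a shell by a continuous function of time -/

/-- **Strict tight crossing times.** If a continuous `f : [0,1] → ℝ` has `f s ≤ q₁ < q₂ ≤ f t`
with `s ≤ t`, there are times `s ≤ s' < t' ≤ t` with `f s' = q₁`, `f t' = q₂` and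
`q₁ < f < q₂` strictly between them (the last time at level `q₁` before the first time at level
`q₂`). [folklore] -/
theorem exists_strict_crossing {f : I → ℝ} (hf : Continuous f) {s t : I} (hst : s ≤ t)
    {q₁ q₂ : ℝ} (hq : q₁ < q₂) (hs : f s ≤ q₁) (ht : q₂ ≤ f t) :
    ∃ s' t' : I, s ≤ s' ∧ s' < t' ∧ t' ≤ t ∧ f s' = q₁ ∧ f t' = q₂ ∧
      ∀ u, s' < u → u < t' → q₁ < f u ∧ f u < q₂ := by
  -- first time at level `≥ q₂`
  set T : Set I := {u | s ≤ u ∧ u ≤ t ∧ q₂ ≤ f u} with hT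
  have hTc : IsClosed T :=
    (isClosed_le continuous_const continuous_id).inter
      ((isClosed_le continuous_id continuous_const).inter (isClosed_le continuous_const hf))
  obtain ⟨t', ⟨hst', ht't, hft'⟩, hmin⟩ := hTc.isCompact.exists_isLeast ⟨t, hst, le_rfl, ht⟩
  have hlt : s < t' := by
    rcases eq_or_lt_of_le hst' with h | h
    · rw [← h] at hft'; linarith
    · exact h
  have hbefore : ∀ u, s ≤ u → u < t' → f u < q₂ := by
    intro u hsu hut'
    by_contra h
    exact absurd (hmin ⟨hsu, hut'.le.trans ht't, not_lt.1 h⟩) (not_le.2 hut')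
  have hft'eq : f t' = q₂ := by
    refine le_antisymm ?_ hft'
    by_contra h
    push Not at h
    have hopen : {u : I | q₂ < f u} ∈ 𝓝 t' := (isOpen_lt continuous_const hf).mem_nhds h
    obtain ⟨l', ⟨hsl', hl't'⟩, hsub⟩ := exists_Ioc_subset_of_mem_nhds' hopen hlt
    obtain ⟨u, hl'u, hut'⟩ := exists_between hl't'
    have h1 : q₂ < f u := hsub ⟨hl'u, hut'.le⟩
    have h2 := hbefore u (hsl'.trans hl'u.le) hut'
    linarith
  -- last time at level `≤ q₁` before `t'`
  set S : Set I := {u | s ≤ u ∧ u ≤ t' ∧ f u ≤ q₁} with hS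
  have hSc : IsClosed S :=
    (isClosed_le continuous_const continuous_id).inter
      ((isClosed_le continuous_id continuous_const).inter (isClosed_le hf continuous_const))
  obtain ⟨s', ⟨hss', hs't', hfs'⟩, hmax⟩ := hSc.isCompact.exists_isGreatest ⟨s, le_rfl, hlt.le, hs⟩
  have hlt' : s' < t' := by
    rcases eq_or_lt_of_le hs't' with h | h
    · rw [h, hft'eq] at hfs'; linarith
    · exact h
  have hafter : ∀ u, s' < u → u ≤ t' → q₁ < f u := by
    intro u hs'u hut'
    by_contra h
    exact absurd (hmax ⟨hss'.trans hs'u.le, hut', not_lt.1 h⟩) (not_le.2 hs'u)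
  have hfs'eq : f s' = q₁ := by
    refine le_antisymm hfs' ?_
    by_contra h
    push Not at h
    have hopen : {u : I | f u < q₁} ∈ 𝓝 s' := (isOpen_lt hf continuous_const).mem_nhds h
    obtain ⟨l', ⟨hs'l', hl't'⟩, hsub⟩ := exists_Ico_subset_of_mem_nhds' hopen hlt'
    obtain ⟨u, hs'u, hul'⟩ := exists_between hs'l'
    have h1 : f u < q₁ := hsub ⟨hs'u.le, hul'⟩
    have h2 := hafter u hs'u (hul'.le.trans hl't')
    linarith
  exact ⟨s', t', hss', hlt', ht't, hfs'eq, hft'eq,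
    fun u hs'u hut' => ⟨hafter u hs'u hut'.le, hbefore u (hss'.trans hs'u.le) hut'⟩⟩

/-- **Strict tight crossing times, downward version** (`f s ≥ q₂ > q₁ ≥ f t`). [folklore] -/
theorem exists_strict_crossing' {f : I → ℝ} (hf : Continuous f) {s t : I} (hst : s ≤ t)
    {q₁ q₂ : ℝ} (hq : q₁ < q₂) (hs : q₂ ≤ f s) (ht : f t ≤ q₁) :
    ∃ s' t' : I, s ≤ s' ∧ s' < t' ∧ t' ≤ t ∧ f s' = q₂ ∧ f t' = q₁ ∧
      ∀ u, s' < u → u < t' → q₁ < f u ∧ f u < q₂ := by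
  obtain ⟨s', t', h1, h2, h3, h4, h5, h6⟩ := exists_strict_crossing (f := fun u => -f u) hf.neg hst
    (neg_lt_neg hq) (neg_le_neg hs) (neg_le_neg ht)
  refine ⟨s', t', h1, h2, h3, by linarith, by linarith, fun u hu1 hu2 => ?_⟩
  have := h6 u hu1 hu2
  constructor <;> linarith [this.1, this.2]

/-- **A strict crossing in either direction** of the levels `q₁ < q₂` inside a traversal of the
shell `D(x; ρ, R)` (`ρ ≤ q₁`, `q₂ ≤ R`) by the curve `γ`. [folklore] -/
theorem exists_strict_crossing_of_isTraversal {γ : Curve ℂ} {x : ℂ} {ρ R q₁ q₂ : ℝ} {s t : I}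
    (h : γ.IsTraversal x ρ R s t) (hρ : ρ ≤ q₁) (hq : q₁ < q₂) (hR : q₂ ≤ R) :
    ∃ s' t' : I, s ≤ s' ∧ s' < t' ∧ t' ≤ t ∧
      ((dist (γ s') x = q₁ ∧ dist (γ t') x = q₂) ∨ (dist (γ s') x = q₂ ∧ dist (γ t') x = q₁)) ∧
      ∀ u, s' < u → u < t' → q₁ < dist (γ u) x ∧ dist (γ u) x < q₂ := by
  have hf : Continuous fun u : I => dist (γ u) x := γ.continuous.dist continuous_const
  rcases h with ⟨hst, ⟨h1, h2⟩ | ⟨h1, h2⟩⟩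
  · obtain ⟨s', t', a1, a2, a3, a4, a5, a6⟩ := exists_strict_crossing hf hst hq (h1.trans hρ) (hR.trans h2)
    exact ⟨s', t', a1, a2, a3, Or.inl ⟨a4, a5⟩, a6⟩
  · obtain ⟨s', t', a1, a2, a3, a4, a5, a6⟩ := exists_strict_crossing' hf hst hq (hR.trans h1) (h2.trans hρ)
    exact ⟨s', t', a1, a2, a3, Or.inr ⟨a4, a5⟩, a6⟩

/-! ### Sub-arcs of a curve as paths -/

/-- The time `s + u (t - s)` of the affine reparametrisation of `[s, t] ⊆ [0, 1]`. [folklore] -/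
def subTime (s t : I) (hst : s ≤ t) (u : I) : I :=
  ⟨s + u * (t - s), by
    have hs := s.2; have ht := t.2; have hu := u.2
    have h1 : (s : ℝ) ≤ t := hst
    constructor
    · nlinarith [hs.1, hu.1]
    · nlinarith [ht.2, hu.2, hu.1]⟩

/-- `subTime` lands in `[s, t]`. [folklore] -/
theorem subTime_mem (s t : I) (hst : s ≤ t) (u : I) : s ≤ subTime s t hst u ∧ subTime s t hst u ≤ t := by
  have hu := u.2
  have h1 : (s : ℝ) ≤ t := hst
  constructor
  · change (s : ℝ) ≤ s + u * (t - s); nlinarith [hu.1]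
  · change (s : ℝ) + u * (t - s) ≤ t; nlinarith [hu.2]

/-- Every time of `[s, t]` is a `subTime`. [folklore] -/
theorem exists_subTime_eq {s t : I} (hst : s ≤ t) {v : I} (hsv : s ≤ v) (hvt : v ≤ t) :
    ∃ u : I, subTime s t hst u = v := by
  rcases eq_or_lt_of_le hst with h | h
  · refine ⟨0, Subtype.ext ?_⟩
    have hv : (v : ℝ) = s := le_antisymm (by rw [h]; exact hvt) hsv
    change (s : ℝ) + (0 : ℝ) * (t - s) = v
    rw [hv]; ring
  · have h' : (s : ℝ) < t := h
    have hsv' : (s : ℝ) ≤ v := hsv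
    have hvt' : (v : ℝ) ≤ t := hvt
    have hpos : (0 : ℝ) < t - s := sub_pos.2 h'
    have h0 : 0 ≤ ((v : ℝ) - s) / (t - s) := div_nonneg (sub_nonneg.2 hsv') hpos.le
    have h1 : ((v : ℝ) - s) / (t - s) ≤ 1 := by
      rw [div_le_one hpos]; exact sub_le_sub_right hvt' _
    refine ⟨⟨((v : ℝ) - s) / (t - s), h0, h1⟩, Subtype.ext ?_⟩
    change (s : ℝ) + (v - s) / (t - s) * (t - s) = v
    field_simp
    ring

/-- **The sub-arc of a curve over `[s, t]`** as a path from `γ s` to `γ t` (affine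
reparametrisation). [folklore] -/
def subArc (γ : Curve ℂ) (s t : I) (hst : s ≤ t) : Path (γ s) (γ t) where
  toFun := fun u => γ (subTime s t hst u)
  continuous_toFun := by
    refine γ.continuous.comp ?_
    refine Continuous.subtype_mk ?_ _
    fun_prop
  source' := by
    congr 1; apply Subtype.ext; change (s : ℝ) + (0 : ℝ) * (t - s) = s; ring
  target' := by
    congr 1; apply Subtype.ext; change (s : ℝ) + (1 : ℝ) * (t - s) = t; ring

/-- The range of the sub-arc is the image of `[s, t]`. [folklore] -/
theorem range_subArc (γ : Curve ℂ) {s t : I} (hst : s ≤ t) :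
    range (subArc γ s t hst) = γ '' {v : I | s ≤ v ∧ v ≤ t} := by
  ext z
  constructor
  · rintro ⟨u, rfl⟩
    exact ⟨subTime s t hst u, subTime_mem s t hst u, rfl⟩
  · rintro ⟨v, ⟨hsv, hvt⟩, rfl⟩
    obtain ⟨u, hu⟩ := exists_subTime_eq hst hsv hvt
    exact ⟨u, by change γ (subTime s t hst u) = γ v; rw [hu]⟩

/-- **The oriented sub-arc**: the sub-arc over `[s, t]`, traversed forwards (`b = true`) or
backwards, packaged with its endpoints. [folklore] -/
def orientedArc (γ : Curve ℂ) (s t : I) (hst : s ≤ t) (b : Bool) : Σ p : ℂ × ℂ, Path p.1 p.2 :=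
  if b then ⟨(γ s, γ t), subArc γ s t hst⟩ else ⟨(γ t, γ s), (subArc γ s t hst).symm⟩

/-- The range of the oriented sub-arc is the image of `[s, t]`. [folklore] -/
theorem range_orientedArc (γ : Curve ℂ) {s t : I} (hst : s ≤ t) (b : Bool) :
    range (orientedArc γ s t hst b).2 = γ '' {v : I | s ≤ v ∧ v ≤ t} := by
  cases b
  · change range (subArc γ s t hst).symm = _
    rw [Path.symm_range, range_subArc]
  · exact range_subArc γ hst

/-- The endpoints of the oriented sub-arc. [folklore] -/
theorem orientedArc_fst (γ : Curve ℂ) {s t : I} (hst : s ≤ t) (b : Bool) :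
    (orientedArc γ s t hst b).1 = if b then (γ s, γ t) else (γ t, γ s) := by
  cases b <;> rfl

/-! ### The side functional along a segment -/

/-- The side functional is positive on a segment whose endpoints are on the positive side.
[folklore] -/
theorem segSide_pos_of_mem_segment {ℓ r A B z : ℂ} (hA : 0 < segSide ℓ r A) (hB : 0 < segSide ℓ r B)
    (hz : z ∈ segment ℝ A B) : 0 < segSide ℓ r z := by
  rw [segment_eq_image_lineMap] at hz
  obtain ⟨v, ⟨h0, h1⟩, rfl⟩ := hz
  rw [segSide_lineMap]
  rcases eq_or_lt_of_le h1 with h | h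
  · rw [h]; simpa using hB
  · nlinarith

/-- The side functional is negative on a segment whose endpoints are on the negative side.
[folklore] -/
theorem segSide_neg_of_mem_segment {ℓ r A B z : ℂ} (hA : segSide ℓ r A < 0) (hB : segSide ℓ r B < 0)
    (hz : z ∈ segment ℝ A B) : segSide ℓ r z < 0 := by
  rw [segment_eq_image_lineMap] at hz
  obtain ⟨v, ⟨h0, h1⟩, rfl⟩ := hz
  rw [segSide_lineMap]
  rcases eq_or_lt_of_le h1 with h | h
  · rw [h]; simpa using hB
  · nlinarith

/-- **The zero of the side functional on a transversal segment is unique**: if the endpoints are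
on opposite sides, two points of the segment with zero side functional coincide. [folklore] -/
theorem eq_of_segSide_eq_zero_of_mem_segment {ℓ r A B z₁ z₂ : ℂ} (hA : 0 < segSide ℓ r A)
    (hB : segSide ℓ r B < 0) (hz₁ : z₁ ∈ segment ℝ A B) (hz₂ : z₂ ∈ segment ℝ A B)
    (h₁ : segSide ℓ r z₁ = 0) (h₂ : segSide ℓ r z₂ = 0) : z₁ = z₂ := by
  rw [segment_eq_image_lineMap] at hz₁ hz₂
  obtain ⟨v₁, -, rfl⟩ := hz₁
  obtain ⟨v₂, -, rfl⟩ := hz₂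
  rw [segSide_lineMap] at h₁ h₂
  have hne : segSide ℓ r A - segSide ℓ r B ≠ 0 := by linarith
  have e1 : v₁ = segSide ℓ r A / (segSide ℓ r A - segSide ℓ r B) := by
    field_simp; linarith
  have e2 : v₂ = segSide ℓ r A / (segSide ℓ r A - segSide ℓ r B) := by
    field_simp; linarith
  rw [e1, ← e2]

/-! ### The constant tail of the polygon of a walk -/

section Tail

variable {E : Type*} [AddCommGroup E] [Module ℝ E] [TopologicalSpace E] [ContinuousAdd E]
  [ContinuousSMul ℝ E]

/-- **The polyline is constant on its tail**: at every time `≥ 1 - 2^{-n}` the polyline through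
`p 0, …, p n` is at its last point. [folklore] -/
theorem polylineFrom_ptsList_eq_of_tailStart_le :
    ∀ (p : ℕ → E) (n : ℕ) {u : I}, tailStart n ≤ (u : ℝ) →
      (polylineFrom (p 0) (ptsList p n)).2 u = (polylineFrom (p 0) (ptsList p n)).2 1
  | p, 0, u, _ => rfl
  | p, n + 1, u, hu => by
    change ((Path.segment (p 0) (p 1)).trans (polylineFrom (p 1) (ptsList (fun k => p (k + 1)) n)).2) u =
      ((Path.segment (p 0) (p 1)).trans (polylineFrom (p 1) (ptsList (fun k => p (k + 1)) n)).2) 1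
    rw [Path.target]
    rw [tailStart_succ] at hu
    have h0 := tailStart_nonneg n
    by_cases hle : (u : ℝ) ≤ 1 / 2
    · -- then `tailStart n = 0`, `n = 0`... in any case `u = 1/2` and the rest starts at `p 1`
      have hu2 : (u : ℝ) = 1 / 2 := le_antisymm hle (by linarith)
      have htn : tailStart n ≤ 0 := by linarith
      rw [trans_apply_of_le _ _ hle]
      have h1 : dblTime u hle = 1 := Subtype.ext (by change 2 * (u : ℝ) = 1; linarith)
      rw [h1, Path.target]
      -- the rest is constant from time `0 ≥ tailStart n`
      have := polylineFrom_ptsList_eq_of_tailStart_le (fun k => p (k + 1)) n (u := 0) htn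
      rw [Path.source, Path.target] at this
      exact this
    · rw [trans_apply_of_not_le _ _ hle]
      have h' : tailStart n ≤ (dblTime' u hle : ℝ) := by
        change tailStart n ≤ 2 * (u : ℝ) - 1; linarith
      rw [polylineFrom_ptsList_eq_of_tailStart_le (fun k => p (k + 1)) n h', Path.target]

end Tail

/-- **The polygon of a walk of `H` is constant on its tail**: for `u ≥ 1 - 2^{-n}` (`n` the
number of darts) it sits at the last vertex. [folklore] -/
theorem toCurve_eq_toCurve_one_of_tailStart_le {f₀ g₀ : HexVertex} {δ : ℝ} (w : hexGraph.Walk f₀ g₀)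
    {u : I} (hu : tailStart w.length ≤ (u : ℝ)) :
    w.toCurve (fun F ↦ (δ : ℂ) * hexCenter F) u = w.toCurve (fun F ↦ (δ : ℂ) * hexCenter F) 1 := by
  rw [toCurve_eq_polylineFrom_ptsList, toCurve_eq_polylineFrom_ptsList]
  exact polylineFrom_ptsList_eq_of_tailStart_le _ _ hu

/-! ### The polygon of an interface loop as a curve -/

/-- The polygon of a walk of `H` at mesh `δ`, as a parametrised curve (`SimpleGraph.Walk.toCurve`
through the rescaled face centres; for an interface loop `γ` its class is `siteLoopCurve δ γ`).
[folklore] -/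
def hexLoopCurve {f₀ g₀ : HexVertex} (δ : ℝ) (w : hexGraph.Walk f₀ g₀) : Curve ℂ :=
  ⟨w.toCurve fun F ↦ (δ : ℂ) * hexCenter F⟩

/-- Pointwise, `hexLoopCurve` is `toCurve`. [folklore] -/
@[simp] theorem loopCurve_apply {f₀ g₀ : HexVertex} (δ : ℝ) (w : hexGraph.Walk f₀ g₀) (u : I) :
    hexLoopCurve δ w u = w.toCurve (fun F ↦ (δ : ℂ) * hexCenter F) u := rfl

/-- The **midpoint of the `m`-th dart piece** at mesh `δ` (where it crosses its side segment).
[folklore] -/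
def pieceMid {f₀ g₀ : HexVertex} (δ : ℝ) (w : hexGraph.Walk f₀ g₀) (m : ℕ) : ℂ :=
  (δ : ℂ) * midpoint ℝ (hexCenter (w.getVert m)) (hexCenter (w.getVert (m + 1)))

/-- Scaling a midpoint. [folklore] -/
theorem mul_midpoint (δ : ℝ) (a b : ℂ) :
    (δ : ℂ) * midpoint ℝ a b = midpoint ℝ ((δ : ℂ) * a) ((δ : ℂ) * b) := by
  simp only [midpoint_eq_smul_add, Complex.real_smul]
  ring

/-- The midpoint of a piece lies on the piece. [folklore] -/
theorem pieceMid_mem_polyPiece {f₀ g₀ : HexVertex} (δ : ℝ) (w : hexGraph.Walk f₀ g₀) (m : ℕ) :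
    pieceMid δ w m ∈ polyPiece δ w m := by
  rw [pieceMid, mul_midpoint]
  exact midpoint_mem_segment _ _

section OneLoop

variable {ω : SiteConfig (Site 2)} {f₀ : HexVertex} {w : hexGraph.Walk f₀ f₀}
  (hw : IsSiteInterfaceLoop ω w) {δ : ℝ} (hδ : 0 < δ)

include hw hδ

omit hδ in
/-- The loop has at least three darts. [folklore] -/
theorem IsSiteInterfaceLoop.three_le_length : 3 ≤ w.length := hw.isCycle.three_le_length

/-- **Distance control along a piece**: the curve at time `u` is within `δ` of the left point of
its current dart. [folklore] -/
theorem IsSiteInterfaceLoop.dist_hexLoopCurve_leftPt_le (u : I) :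
    dist (hexLoopCurve δ w u) (hw.leftPt δ (polyIdx w.length u)) ≤ δ := by
  have hlen : 0 < w.length := by have := hw.three_le_length; omega
  exact hw.polyPiece_subset_closedBall hδ.le (polyIdx_lt hlen u) (toCurve_mem_polyPiece hlen u)

/-- Two points of the same piece are within `2δ`. [folklore] -/
theorem IsSiteInterfaceLoop.dist_le_two_mul_of_mem_polyPiece {k : ℕ} (hk : k < w.length) {z z' : ℂ}
    (hz : z ∈ polyPiece δ w k) (hz' : z' ∈ polyPiece δ w k) : dist z z' ≤ 2 * δ := by
  have h1 := hw.polyPiece_subset_closedBall hδ.le hk hz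
  have h2 := hw.polyPiece_subset_closedBall hδ.le hk hz'
  rw [mem_closedBall] at h1 h2
  linarith [dist_triangle z (hw.leftPt δ k) z', dist_comm z' (hw.leftPt δ k)]

/-- **Times with different current darts**: if the curve is at radial distances more than `2δ`
apart at two times, the darts differ. [folklore] -/
theorem IsSiteInterfaceLoop.polyIdx_ne_of_dist {x : ℂ} {u v : I}
    (h : 2 * δ < |dist (hexLoopCurve δ w u) x - dist (hexLoopCurve δ w v) x|) :
    polyIdx w.length u ≠ polyIdx w.length v := by
  intro heq
  have hlen : 0 < w.length := by have := hw.three_le_length; omega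
  have h1 := toCurve_mem_polyPiece (δ := δ) hlen u
  have h2 := toCurve_mem_polyPiece (δ := δ) hlen v
  rw [heq] at h1
  have hd := hw.dist_le_two_mul_of_mem_polyPiece hδ (polyIdx_lt hlen v) h1 h2
  have := abs_dist_sub_le (hexLoopCurve δ w u) (hexLoopCurve δ w v) x
  change dist (hexLoopCurve δ w u) (hexLoopCurve δ w v) ≤ 2 * δ at hd
  linarith

/-- The midpoint of the `m`-th piece lies on the `m`-th side segment. [folklore] -/
theorem IsSiteInterfaceLoop.pieceMid_mem_sideSeg {m : ℕ} (hm : m < w.length) : pieceMid δ w m ∈ hw.sideSeg δ m := by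
  rw [IsSiteInterfaceLoop.sideSeg, IsSiteInterfaceLoop.leftPt, IsSiteInterfaceLoop.rightPt, triMeshPoint, triMeshPoint,
    pieceMid, mem_segment_mul_iff hδ.ne', hw.lv_eq hm, hw.rv_eq hm, hw.getVert_succ_eq hm, midpoint_hexCenter_oppFace,
    Complex.real_smul, Complex.ofReal_inv, ← mul_assoc, inv_mul_cancel₀ (Complex.ofReal_ne_zero.2 hδ.ne'), one_mul,
    segment_symm]
  exact midpoint_mem_segment _ _

/-- The side functional of the `m`-th crossed edge vanishes at the midpoint of the `m`-th piece.
[folklore] -/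
theorem IsSiteInterfaceLoop.segSide_pieceMid {m : ℕ} (hm : m < w.length) :
    segSide (hw.leftPt δ m) (hw.rightPt δ m) (pieceMid δ w m) = 0 :=
  segSide_eq_zero_of_mem_segment (hw.pieceMid_mem_sideSeg hδ hm)

/-- The midpoint is within `δ` of the left point. [folklore] -/
theorem IsSiteInterfaceLoop.dist_pieceMid_leftPt_le {m : ℕ} (hm : m < w.length) :
    dist (pieceMid δ w m) (hw.leftPt δ m) ≤ δ :=
  hw.polyPiece_subset_closedBall hδ.le hm (pieceMid_mem_polyPiece δ w m)

/-- The midpoint is on the trace, the left point is not: they differ. [folklore] -/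
theorem IsSiteInterfaceLoop.leftPt_ne_pieceMid {m : ℕ} (hm : m < w.length) : hw.leftPt δ m ≠ pieceMid δ w m := fun h ↦
  hw.leftPt_not_mem_polyTrace hδ m (h ▸ polyPiece_subset_polyTrace hm (pieceMid_mem_polyPiece δ w m))

/-! ### The middle dart of a strict crossing -/

/-- **A middle dart away from the base point.** Along a strict crossing `[c, d]` of the levels
`p₁ < p₂` with `p₁ + 18δ ≤ p₂` there is a time `u` strictly inside whose current dart `m` is
neither the first nor the last dart of the loop and whose radial distance is more than `2δ` away
from both levels: of the three times at the levels `(p₁+p₂)/2 + 3iδ`, `i = 0, 1, 2`, the current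
darts are pairwise distinct. [folklore] -/
theorem IsSiteInterfaceLoop.exists_middle_dart {x : ℂ} {p₁ p₂ : ℝ} (hp : p₁ + 18 * δ ≤ p₂) {c d : I} (hcd : c < d)
    (hends : (dist (hexLoopCurve δ w c) x = p₁ ∧ dist (hexLoopCurve δ w d) x = p₂) ∨
      (dist (hexLoopCurve δ w c) x = p₂ ∧ dist (hexLoopCurve δ w d) x = p₁)) :
    ∃ (u : I) (m : ℕ), c < u ∧ u < d ∧ polyIdx w.length u = m ∧ 1 ≤ m ∧ m + 2 ≤ w.length ∧
      p₁ + 2 * δ < dist (hexLoopCurve δ w u) x ∧ dist (hexLoopCurve δ w u) x < p₂ - 2 * δ := by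
  have hlen : 0 < w.length := by have := hw.three_le_length; omega
  set f : I → ℝ := fun u => dist (hexLoopCurve δ w u) x with hf
  have hfc : Continuous f := (hexLoopCurve δ w).continuous.dist continuous_const
  -- three levels
  have hlev : ∀ i : Fin 3, ∃ u : I, c < u ∧ u < d ∧ f u = (p₁ + p₂) / 2 + 3 * (i : ℕ) * δ := by
    intro i
    have hi : ((i : ℕ) : ℝ) ≤ 2 := by exact_mod_cast Nat.lt_succ_iff.1 i.2
    have hr1 : p₁ < (p₁ + p₂) / 2 + 3 * (i : ℕ) * δ := by
      have : (0 : ℝ) ≤ (i : ℕ) := Nat.cast_nonneg _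
      nlinarith
    have hr2 : (p₁ + p₂) / 2 + 3 * (i : ℕ) * δ < p₂ := by nlinarith
    obtain ⟨u, ⟨hcu, hud⟩, hu⟩ : (p₁ + p₂) / 2 + 3 * (i : ℕ) * δ ∈ f '' Icc c d := by
      rcases hends with ⟨h1, h2⟩ | ⟨h1, h2⟩
      · exact intermediate_value_Icc hcd.le hfc.continuousOn ⟨by rw [show f c = p₁ from h1]; linarith,
          by rw [show f d = p₂ from h2]; linarith⟩
      · exact intermediate_value_Icc' hcd.le hfc.continuousOn ⟨by rw [show f d = p₁ from h2]; linarith,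
          by rw [show f c = p₂ from h1]; linarith⟩
    refine ⟨u, lt_of_le_of_ne hcu ?_, lt_of_le_of_ne hud ?_, hu⟩
    · rintro rfl
      rcases hends with ⟨h1, -⟩ | ⟨h1, -⟩ <;> rw [show f c = _ from h1] at hu <;> linarith
    · rintro rfl
      rcases hends with ⟨-, h2⟩ | ⟨-, h2⟩ <;> rw [show f u = _ from h2] at hu <;> linarith
  choose u hcu hud hfu using hlev
  -- the three darts are pairwise distinct
  have hne : ∀ i i' : Fin 3, i ≠ i' → polyIdx w.length (u i) ≠ polyIdx w.length (u i') := by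
    intro i i' hii'
    refine hw.polyIdx_ne_of_dist hδ (x := x) ?_
    change 2 * δ < |f (u i) - f (u i')|
    rw [hfu, hfu]
    have : (1 : ℝ) ≤ |((i : ℕ) : ℝ) - (i' : ℕ)| := by
      have h : (i : ℕ) ≠ (i' : ℕ) := fun h => hii' (Fin.ext h)
      rcases lt_or_gt_of_ne h with hlt | hlt
      · have : ((i : ℕ) : ℝ) + 1 ≤ (i' : ℕ) := by exact_mod_cast hlt
        rw [abs_of_neg (by linarith)]; linarith
      · have : ((i' : ℕ) : ℝ) + 1 ≤ (i : ℕ) := by exact_mod_cast hlt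
        rw [abs_of_pos (by linarith)]; linarith
    have e : (p₁ + p₂) / 2 + 3 * ((i : ℕ) : ℝ) * δ - ((p₁ + p₂) / 2 + 3 * ((i' : ℕ) : ℝ) * δ) =
        3 * δ * (((i : ℕ) : ℝ) - (i' : ℕ)) := by ring
    rw [e, abs_mul, abs_of_pos (by positivity)]
    nlinarith
  -- one of them is neither `0` nor `n - 1`
  obtain ⟨i, hi0, hi1⟩ : ∃ i : Fin 3, polyIdx w.length (u i) ≠ 0 ∧ polyIdx w.length (u i) ≠ w.length - 1 := by
    by_contra hcon
    push Not at hcon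
    have h01 := hne 0 1 (by decide)
    have h02 := hne 0 2 (by decide)
    have h12 := hne 1 2 (by decide)
    rcases eq_or_ne (polyIdx w.length (u 0)) 0 with h0 | h0
    · rcases eq_or_ne (polyIdx w.length (u 1)) 0 with h1 | h1
      · exact h01 (h0.trans h1.symm)
      · have h1' := hcon 1 h1
        rcases eq_or_ne (polyIdx w.length (u 2)) 0 with h2 | h2
        · exact h02 (h0.trans h2.symm)
        · exact h12 (h1'.trans (hcon 2 h2).symm)
    · have h0' := hcon 0 h0
      rcases eq_or_ne (polyIdx w.length (u 1)) 0 with h1 | h1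
      · rcases eq_or_ne (polyIdx w.length (u 2)) 0 with h2 | h2
        · exact h12 (h1.trans h2.symm)
        · exact h02 (h0'.trans (hcon 2 h2).symm)
      · exact h01 (h0'.trans (hcon 1 h1).symm)
  have hlt := polyIdx_lt hlen (u i)
  refine ⟨u i, polyIdx w.length (u i), hcu i, hud i, rfl, by omega, by omega, ?_, ?_⟩
  · have := hfu i
    have h0 : (0 : ℝ) ≤ (i : ℕ) := Nat.cast_nonneg _
    change f (u i) > _
    rw [this]; nlinarith
  · have := hfu i
    have hi2 : ((i : ℕ) : ℝ) ≤ 2 := by exact_mod_cast Nat.lt_succ_iff.1 i.2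
    change f (u i) < _
    rw [this]; nlinarith

/-! ### The midpoint of the middle dart is on the crossing -/

/-- **The crossing passes through the midpoint of its middle dart.** In the setting of
`exists_middle_dart` (`u` strictly inside the strict crossing `[c, d]` of the levels `p₁ < p₂`,
current dart `m` with `1 ≤ m`, `m + 2 ≤ n`, radial distance of `Γ u` more than `2δ` from both
levels), there is a time `u₁ ∈ [c, d]` with `Γ u₁ =` the midpoint of the `m`-th piece: the crossing
visits the darts `m - 1` and `m + 1` within `[c, d]`, where the side functional of the crossed edge
of dart `m` is positive, resp. negative (`segSide_polyPt_pred_pos`, `segSide_polyPt_succ_succ_neg`);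
by the intermediate value theorem it vanishes at some intermediate time, whose point lies on the
`m`-th piece, where the only zero is the midpoint. [folklore] -/
theorem IsSiteInterfaceLoop.exists_eq_pieceMid {x : ℂ} {p₁ p₂ : ℝ} {c d u : I} (hcu : c < u) (hud : u < d)
    (hends : (dist (hexLoopCurve δ w c) x = p₁ ∧ dist (hexLoopCurve δ w d) x = p₂) ∨
      (dist (hexLoopCurve δ w c) x = p₂ ∧ dist (hexLoopCurve δ w d) x = p₁))
    {m : ℕ} (hm : polyIdx w.length u = m) (hm1 : 1 ≤ m) (hm2 : m + 2 ≤ w.length)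
    (hfar1 : p₁ + 2 * δ < dist (hexLoopCurve δ w u) x) (hfar2 : dist (hexLoopCurve δ w u) x < p₂ - 2 * δ) :
    ∃ u₁ : I, c ≤ u₁ ∧ u₁ ≤ d ∧ hexLoopCurve δ w u₁ = pieceMid δ w m := by
  have hlen : 0 < w.length := by omega
  have hn : m < w.length := by omega
  set Γ := hexLoopCurve δ w with hΓ
  -- the endpoints `c`, `d` are not on dart `m`
  have hfar : ∀ v : I, (dist (Γ v) x = p₁ ∨ dist (Γ v) x = p₂) → polyIdx w.length v ≠ m := by
    intro v hv heq
    have h1 := toCurve_mem_polyPiece (δ := δ) hlen v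
    have h2 := toCurve_mem_polyPiece (δ := δ) hlen u
    rw [heq] at h1; rw [hm] at h2
    have hd := hw.dist_le_two_mul_of_mem_polyPiece hδ hn h1 h2
    change dist (Γ v) (Γ u) ≤ 2 * δ at hd
    have := abs_dist_sub_le (Γ v) (Γ u) x
    rcases hv with hv | hv <;> rw [hv] at this <;>
      [have := (abs_le.1 (this.trans hd)).1; have := (abs_le.1 (this.trans hd)).2] <;> linarith
  have hc' : dist (Γ c) x = p₁ ∨ dist (Γ c) x = p₂ := by
    rcases hends with ⟨h, -⟩ | ⟨h, -⟩; exacts [Or.inl h, Or.inr h]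
  have hd' : dist (Γ d) x = p₁ ∨ dist (Γ d) x = p₂ := by
    rcases hends with ⟨-, h⟩ | ⟨-, h⟩; exacts [Or.inr h, Or.inl h]
  have hic : polyIdx w.length c ≤ m - 1 := by
    have h1 : polyIdx w.length c ≤ m := hm ▸ polyIdx_mono _ hcu.le
    have h2 := hfar c hc'
    omega
  have hid : m + 1 ≤ polyIdx w.length d := by
    have h1 : m ≤ polyIdx w.length d := hm ▸ polyIdx_mono _ hud.le
    have h2 := hfar d hd'
    omega
  -- times on the darts `m - 1` and `m + 1`
  obtain ⟨um, hcm, hmd, hum⟩ := exists_time_of_polyIdx w.length (hcu.le.trans hud.le) hic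
    (show m - 1 ≤ polyIdx w.length d by omega)
  obtain ⟨up, hcp, hpd, hup⟩ := exists_time_of_polyIdx w.length (hcu.le.trans hud.le)
    (show polyIdx w.length c ≤ m + 1 by omega) hid
  have hmp : um < up := by
    by_contra h
    have := polyIdx_mono w.length (not_lt.1 h)
    rw [hum, hup] at this
    omega
  -- the side functional of the crossed edge of dart `m`
  set φ : ℂ → ℝ := fun z => segSide (hw.leftPt δ m) (hw.rightPt δ m) z with hφ
  have hφc : Continuous φ := by
    simp only [hφ, segSide]
    fun_prop
  -- signs at the two times
  have hne1 : w.getVert (m - 1) ≠ w.getVert (m + 1) := by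
    intro h
    obtain ⟨h1, h2⟩ := getVert_inj_of_isCycle hw.isCycle (m - 1) (m + 1) (by omega) (by omega) h
    omega
  have hne2 : w.getVert (m + 2) ≠ w.getVert m := by
    intro h
    obtain ⟨h1, -⟩ := getVert_inj_of_isCycle hw.isCycle m (m + 2) (by omega) hm2 h.symm
    omega
  have hpos : 0 < φ (Γ um) := by
    have h1 := toCurve_mem_polyPiece (δ := δ) hlen um
    rw [hum, polyPiece, show m - 1 + 1 = m by omega] at h1
    exact segSide_pos_of_mem_segment (hw.segSide_polyPt_pred_pos hδ hm1 hn hne1) (hw.segSide_polyPt_pos hδ hn) h1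
  have hneg : φ (Γ up) < 0 := by
    have h1 := toCurve_mem_polyPiece (δ := δ) hlen up
    rw [hup, polyPiece, show m + 1 + 1 = m + 2 by omega] at h1
    exact segSide_neg_of_mem_segment (hw.segSide_polyPt_succ_neg hδ hn)
      (hw.segSide_polyPt_succ_succ_neg hδ (by omega) hne2) h1
  -- a zero in between
  have hgc : Continuous fun v : I => φ (Γ v) := hφc.comp Γ.continuous
  obtain ⟨u₁, ⟨hmu₁, hu₁p⟩, hzero⟩ : (0 : ℝ) ∈ (fun v : I => φ (Γ v)) '' Icc um up :=
    intermediate_value_Icc' hmp.le hgc.continuousOn ⟨hneg.le, hpos.le⟩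
  -- its point is on dart `m`
  have hj1 : m - 1 ≤ polyIdx w.length u₁ := hum ▸ polyIdx_mono _ hmu₁
  have hj2 : polyIdx w.length u₁ ≤ m + 1 := hup ▸ polyIdx_mono _ hu₁p
  have hmem := toCurve_mem_polyPiece (δ := δ) hlen u₁
  have hjm : polyIdx w.length u₁ = m := by
    rcases Nat.lt_trichotomy (polyIdx w.length u₁) m with hlt | heq | hgt
    · exfalso
      have : polyIdx w.length u₁ = m - 1 := by omega
      rw [this, polyPiece, show m - 1 + 1 = m by omega] at hmem
      have := segSide_pos_of_mem_segment (hw.segSide_polyPt_pred_pos hδ hm1 hn hne1) (hw.segSide_polyPt_pos hδ hn) hmem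
      have hz : segSide (hw.leftPt δ m) (hw.rightPt δ m) (w.toCurve (fun F ↦ (δ : ℂ) * hexCenter F) u₁) = 0 := hzero
      linarith
    · exact heq
    · exfalso
      have : polyIdx w.length u₁ = m + 1 := by omega
      rw [this, polyPiece, show m + 1 + 1 = m + 2 by omega] at hmem
      have := segSide_neg_of_mem_segment (hw.segSide_polyPt_succ_neg hδ hn)
        (hw.segSide_polyPt_succ_succ_neg hδ (by omega) hne2) hmem
      have hz : segSide (hw.leftPt δ m) (hw.rightPt δ m) (w.toCurve (fun F ↦ (δ : ℂ) * hexCenter F) u₁) = 0 := hzero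
      linarith
  rw [hjm] at hmem
  refine ⟨u₁, hcm.trans hmu₁, hu₁p.trans hpd, ?_⟩
  exact eq_of_segSide_eq_zero_of_mem_segment (hw.segSide_polyPt_pos hδ hn) (hw.segSide_polyPt_succ_neg hδ hn)
    hmem (pieceMid_mem_polyPiece δ w m) hzero (hw.segSide_pieceMid hδ hn)

/-! ### The component of the left hexagon of the middle dart touches the midpoint -/

/-- **The midpoint is in the closure of the component of the left point.** If the closed
`δ`-ball about the left point of dart `m` lies in the open set `U`, then the midpoint of the
`m`-th piece lies in the closure of the component of the left point in `U` minus the trace: the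
half side from the left point to the midpoint, minus the midpoint, is a connected subset of
`U` off the trace. [folklore] -/
theorem IsSiteInterfaceLoop.pieceMid_mem_closure_connectedComponentIn {U : Set ℂ} {m : ℕ} (hm : m < w.length)
    (hball : closedBall (hw.leftPt δ m) δ ⊆ U) :
    pieceMid δ w m ∈ closure (connectedComponentIn (U \ polyTrace δ w) (hw.leftPt δ m)) := by
  set P := hw.leftPt δ m with hP
  set M := pieceMid δ w m with hM
  set g : ℝ → ℂ := fun θ => AffineMap.lineMap P M θ with hg
  have hgc : Continuous g := AffineMap.lineMap_continuous
  -- the half-open side `g '' [0, 1)` is connected, off the trace, in `U`, and contains `P`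
  have hsub : g '' Ico (0 : ℝ) 1 ⊆ U \ polyTrace δ w := by
    rintro z ⟨θ, ⟨h0, h1⟩, rfl⟩
    have hzseg : g θ ∈ segment ℝ P M := by
      rw [segment_eq_image_lineMap]; exact ⟨θ, ⟨h0, h1.le⟩, rfl⟩
    refine ⟨hball ?_, hw.not_mem_polyTrace_of_mem_segment_leftPt hδ hm hzseg ?_⟩
    · exact (convex_closedBall _ _).segment_subset (mem_closedBall_self hδ.le)
        (mem_closedBall.2 (hw.dist_pieceMid_leftPt_le hδ hm)) hzseg
    · -- `g θ ≠ M` for `θ < 1`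
      intro h
      have h2 : AffineMap.lineMap P M θ = AffineMap.lineMap P M (1 : ℝ) := by
        rw [AffineMap.lineMap_apply_one]; exact h
      have := AffineMap.lineMap_injective ℝ (hw.leftPt_ne_pieceMid hδ hm) h2
      linarith
  have hconn : IsPreconnected (g '' Ico (0 : ℝ) 1) := isPreconnected_Ico.image _ hgc.continuousOn
  have hPmem : P ∈ g '' Ico (0 : ℝ) 1 := ⟨0, ⟨le_rfl, zero_lt_one⟩, by simp [hg]⟩
  have hS : g '' Ico (0 : ℝ) 1 ⊆ connectedComponentIn (U \ polyTrace δ w) P :=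
    hconn.subset_connectedComponentIn hPmem hsub
  -- `M = g 1` is in the closure of `g '' [0, 1)`
  have hMcl : M ∈ closure (g '' Ico (0 : ℝ) 1) := by
    have h1 : M = g 1 := by simp [hg]
    rw [h1]
    refine image_closure_subset_closure_image hgc ⟨1, ?_, rfl⟩
    rw [closure_Ico zero_ne_one]; exact ⟨zero_le_one, le_rfl⟩
  exact closure_mono hS hMcl

/-! ### The left chain of a strict crossing -/

/-- **The left sites along a strict crossing.** Along a strict crossing `[c, d]` of the levels
`p₁ < p₂` (either direction), the left points of the darts `polyIdx c, …, polyIdx d` are within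
`δ` of radial distances in `[p₁, p₂]`; in particular, if the closed `2δ`-neighbourhood of the
closed shell `[p₁, p₂]` lies in the open set `U`, all these left points lie in the component of
any one of them in `U` minus the trace. [folklore] -/
theorem IsSiteInterfaceLoop.leftPt_chain {x : ℂ} {p₁ p₂ : ℝ} {c d : I} (hcd : c ≤ d)
    (hends : (dist (hexLoopCurve δ w c) x = p₁ ∧ dist (hexLoopCurve δ w d) x = p₂) ∨
      (dist (hexLoopCurve δ w c) x = p₂ ∧ dist (hexLoopCurve δ w d) x = p₁))
    (hmid : ∀ v, c ≤ v → v ≤ d → p₁ ≤ dist (hexLoopCurve δ w v) x ∧ dist (hexLoopCurve δ w v) x ≤ p₂) :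
    (∀ k, polyIdx w.length c ≤ k → k ≤ polyIdx w.length d →
      p₁ - δ ≤ dist (hw.leftPt δ k) x ∧ dist (hw.leftPt δ k) x ≤ p₂ + δ) ∧
    ((dist (hw.leftPt δ (polyIdx w.length c)) x ≤ p₁ + δ ∧ p₂ - δ ≤ dist (hw.leftPt δ (polyIdx w.length d)) x) ∨
      (p₂ - δ ≤ dist (hw.leftPt δ (polyIdx w.length c)) x ∧ dist (hw.leftPt δ (polyIdx w.length d)) x ≤ p₁ + δ)) := by
  set Γ := hexLoopCurve δ w with hΓ
  have hnear : ∀ v : I, |dist (hw.leftPt δ (polyIdx w.length v)) x - dist (Γ v) x| ≤ δ := fun v =>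
    (abs_dist_sub_le _ _ _).trans (by rw [dist_comm]; exact hw.dist_hexLoopCurve_leftPt_le hδ v)
  constructor
  · intro k hk1 hk2
    obtain ⟨v, hcv, hvd, hv⟩ := exists_time_of_polyIdx w.length hcd hk1 hk2
    have h1 := hnear v
    rw [hv] at h1
    obtain ⟨h2, h3⟩ := hmid v hcv hvd
    rw [abs_le] at h1
    constructor <;> linarith [h1.1, h1.2]
  · have h1 := hnear c
    have h2 := hnear d
    rw [abs_le] at h1 h2
    rcases hends with ⟨hc, hd⟩ | ⟨hc, hd⟩
    · left
      rw [show dist (Γ c) x = p₁ from hc] at h1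
      rw [show dist (Γ d) x = p₂ from hd] at h2
      constructor <;> linarith [h1.1, h1.2, h2.1, h2.2]
    · right
      rw [show dist (Γ c) x = p₂ from hc] at h1
      rw [show dist (Γ d) x = p₁ from hd] at h2
      constructor <;> linarith [h1.1, h1.2, h2.1, h2.2]

/-! ### All the data attached to one traversal -/

omit hw hδ in
/-- A time strictly between `max a τ` and `b` (for `a < b`, `τ < b`), as an element of `[0, 1]`.
[folklore] -/
theorem exists_time_between {a b : I} (hab : a < b) {τ : ℝ} (hτ : τ < b) (hτ0 : 0 ≤ τ) :
    ∃ v : I, a < v ∧ v < b ∧ τ ≤ (v : ℝ) := by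
  have hab' : (a : ℝ) < b := hab
  have hm : max (a : ℝ) τ < b := max_lt hab' hτ
  refine ⟨⟨(max (a : ℝ) τ + b) / 2, ?_, ?_⟩, ?_, ?_, ?_⟩
  · have ha := a.2.1; have hb := b.2.1
    linarith [le_max_left (a : ℝ) τ]
  · have := b.2.2; linarith [le_max_left (a : ℝ) τ, a.2.1]
  · change (a : ℝ) < (max (a : ℝ) τ + b) / 2; linarith [le_max_left (a : ℝ) τ]
  · change (max (a : ℝ) τ + b) / 2 < b; linarith
  · change τ ≤ (max (a : ℝ) τ + b) / 2; linarith [le_max_right (a : ℝ) τ]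

/-- **The data of one traversal.** Let the polygon `Γ` of the interface loop traverse
`D(x; ρ, R)` between the times `s ≤ t` with `s > 0`, and let `ρ ≤ q₁`, `q₁ + 40δ ≤ q₂ ≤ R`. Then
there are: a strict crossing `[a, b] ⊆ [s, t]` of the shell `q₁ ≤ |z - x| ≤ q₂` (direction `dir`),
whose times lie in `(0, 1 - 2^{-n}]`; a dart `m` whose piece midpoint lies on `Γ([a, b])`, in the
open annulus `U`, and in the closure of the component `S` of the left point of `m` in `U` minus the
trace; and a stretch of darts `k₀ ≤ … ≤ k₁` whose left points lie in `S`, within `q₂ - 7δ` of `x`,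
the first within `q₁ + 9δ` and the last beyond `q₂ - 9δ` (or conversely). [cite: AizenmanBurchardDuke1999, Appendix A] -/
theorem IsSiteInterfaceLoop.exists_traversal_data {x : ℂ} {ρ R q₁ q₂ : ℝ} (hρq : ρ ≤ q₁)
    (hgap : q₁ + 40 * δ ≤ q₂) (hqR : q₂ ≤ R) {s t : I} (hs0 : 0 < (s : ℝ))
    (htr : (hexLoopCurve δ w).IsTraversal x ρ R s t) :
    ∃ (a b : I) (dir : Bool) (m k₀ k₁ : ℕ),
      s ≤ a ∧ a < b ∧ b ≤ t ∧
      (∀ v, a ≤ v → v ≤ b → 0 < (v : ℝ) ∧ (v : ℝ) ≤ tailStart w.length) ∧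
      (dist (hexLoopCurve δ w a) x = if dir then q₁ else q₂) ∧
      (dist (hexLoopCurve δ w b) x = if dir then q₂ else q₁) ∧
      (∀ v, a < v → v < b → q₁ < dist (hexLoopCurve δ w v) x ∧ dist (hexLoopCurve δ w v) x < q₂) ∧
      m < w.length ∧
      pieceMid δ w m ∈ hexLoopCurve δ w '' {v | a ≤ v ∧ v ≤ b} ∧
      (q₁ < dist (pieceMid δ w m) x ∧ dist (pieceMid δ w m) x < q₂) ∧
      pieceMid δ w m ∈ closure (connectedComponentIn
        ({z | q₁ < dist z x ∧ dist z x < q₂} \ polyTrace δ w) (hw.leftPt δ m)) ∧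
      k₀ ≤ k₁ ∧ k₁ < w.length ∧
      (∀ k, k₀ ≤ k → k ≤ k₁ → hw.leftPt δ k ∈ connectedComponentIn
        ({z | q₁ < dist z x ∧ dist z x < q₂} \ polyTrace δ w) (hw.leftPt δ m)) ∧
      (∀ k, k₀ ≤ k → k ≤ k₁ → dist (hw.leftPt δ k) x ≤ q₂ - 7 * δ) ∧
      ((dist (hw.leftPt δ k₀) x ≤ q₁ + 9 * δ ∧ q₂ - 9 * δ ≤ dist (hw.leftPt δ k₁) x) ∨
        (q₂ - 9 * δ ≤ dist (hw.leftPt δ k₀) x ∧ dist (hw.leftPt δ k₁) x ≤ q₁ + 9 * δ)) := by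
  set Γ := hexLoopCurve δ w with hΓ
  set U : Set ℂ := {z | q₁ < dist z x ∧ dist z x < q₂} with hU
  have hlen : 0 < w.length := by have := hw.three_le_length; omega
  have hq : q₁ < q₂ := by linarith
  -- the outer strict crossing
  obtain ⟨a, b, hsa, hab, hbt, hlev, hstrict⟩ := exists_strict_crossing_of_isTraversal htr hρq hq hqR
  -- its times are in `(0, τ]`
  have htimes : ∀ v, a ≤ v → v ≤ b → 0 < (v : ℝ) ∧ (v : ℝ) ≤ tailStart w.length := by
    have hbτ : (b : ℝ) ≤ tailStart w.length := by
      by_contra h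
      push Not at h
      obtain ⟨v, hav, hvb, hτv⟩ := exists_time_between hab h (tailStart_nonneg _)
      have h1 : Γ v = Γ 1 := toCurve_eq_toCurve_one_of_tailStart_le w hτv
      have h2 : Γ b = Γ 1 := toCurve_eq_toCurve_one_of_tailStart_le w h.le
      have h3 := hstrict v hav hvb
      rw [h1, ← h2] at h3
      rcases hlev with ⟨-, hb⟩ | ⟨-, hb⟩ <;> rw [hb] at h3 <;> linarith [h3.1, h3.2]
    intro v hav hvb
    have hsa' : (s : ℝ) ≤ a := hsa
    have hav' : (a : ℝ) ≤ v := hav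
    have hvb' : (v : ℝ) ≤ b := hvb
    exact ⟨by linarith, hvb'.trans hbτ⟩
  -- the inner strict crossing of the levels `p₁ = q₁ + 8δ`, `p₂ = q₂ - 8δ`
  have htrav' : Γ.IsTraversal x q₁ q₂ a b := by
    refine ⟨hab.le, ?_⟩
    rcases hlev with ⟨ha, hb⟩ | ⟨ha, hb⟩
    · exact Or.inl ⟨ha.le, hb.ge⟩
    · exact Or.inr ⟨ha.ge, hb.le⟩
  obtain ⟨c, d, hac, hcd, hdb, hlev', hstrict'⟩ := exists_strict_crossing_of_isTraversal htrav'
    (show q₁ ≤ q₁ + 8 * δ by linarith) (show q₁ + 8 * δ < q₂ - 8 * δ by linarith) (show q₂ - 8 * δ ≤ q₂ by linarith)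
  have hmid' : ∀ v, c ≤ v → v ≤ d → q₁ + 8 * δ ≤ dist (Γ v) x ∧ dist (Γ v) x ≤ q₂ - 8 * δ := by
    intro v hcv hvd
    rcases eq_or_lt_of_le hcv with h | h
    · subst h
      rcases hlev' with ⟨h1, -⟩ | ⟨h1, -⟩ <;> rw [h1] <;> constructor <;> linarith
    rcases eq_or_lt_of_le hvd with h' | h'
    · subst h'
      rcases hlev' with ⟨-, h1⟩ | ⟨-, h1⟩ <;> rw [h1] <;> constructor <;> linarith
    exact ⟨(hstrict' v h h').1.le, (hstrict' v h h').2.le⟩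
  -- the middle dart and the midpoint on the crossing
  obtain ⟨u, m, hcu, hud, hm, hm1, hm2, hfar1, hfar2⟩ :=
    hw.exists_middle_dart hδ (show q₁ + 8 * δ + 18 * δ ≤ q₂ - 8 * δ by linarith) hcd hlev'
  have hn : m < w.length := by omega
  obtain ⟨u₁, hcu₁, hu₁d, hu₁⟩ := hw.exists_eq_pieceMid hδ hcu hud hlev' hm hm1 hm2 hfar1 hfar2
  -- distances of the left point of `m` and of the midpoint
  have hleft : dist (hw.leftPt δ m) x ≤ dist (Γ u) x + δ ∧ dist (Γ u) x - δ ≤ dist (hw.leftPt δ m) x := by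
    have h := hw.dist_hexLoopCurve_leftPt_le hδ u
    rw [hm] at h
    constructor
    · linarith [dist_triangle (hw.leftPt δ m) (Γ u) x, dist_comm (Γ u) (hw.leftPt δ m)]
    · linarith [dist_triangle (Γ u) (hw.leftPt δ m) x]
  have hMdist : q₁ < dist (pieceMid δ w m) x ∧ dist (pieceMid δ w m) x < q₂ := by
    have h1 := hw.dist_pieceMid_leftPt_le hδ hn
    constructor
    · linarith [dist_triangle (hw.leftPt δ m) (pieceMid δ w m) x, dist_comm (pieceMid δ w m) (hw.leftPt δ m), hleft.2]
    · linarith [dist_triangle (pieceMid δ w m) (hw.leftPt δ m) x, hleft.1]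
  have hballU : closedBall (hw.leftPt δ m) δ ⊆ U := by
    intro z hz
    rw [mem_closedBall] at hz
    constructor
    · linarith [dist_triangle (hw.leftPt δ m) z x, dist_comm z (hw.leftPt δ m), hleft.2]
    · linarith [dist_triangle z (hw.leftPt δ m) x, hleft.1]
  -- the chain
  obtain ⟨hchain, hends⟩ := hw.leftPt_chain hδ hcd.le hlev' hmid'
  have hk₀k₁ : polyIdx w.length c ≤ polyIdx w.length d := polyIdx_mono _ hcd.le
  have hk₁ : polyIdx w.length d < w.length := polyIdx_lt hlen d
  have hmk : polyIdx w.length c ≤ m ∧ m ≤ polyIdx w.length d :=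
    ⟨hm ▸ polyIdx_mono _ hcu.le, hm ▸ polyIdx_mono _ hud.le⟩
  have hcomp : ∀ k, polyIdx w.length c ≤ k → k ≤ polyIdx w.length d →
      hw.leftPt δ k ∈ connectedComponentIn (U \ polyTrace δ w) (hw.leftPt δ m) := by
    intro k hk1 hk2
    refine hw.leftPt_mem_connectedComponentIn hδ hk₁ (fun i hi1 hi2 z hz ↦ ?_) hk1 hk2 hmk.1 hmk.2
    obtain ⟨h1, h2⟩ := hchain i hi1 hi2
    rw [mem_closedBall] at hz
    constructor
    · linarith [dist_triangle (hw.leftPt δ i) z x, dist_comm z (hw.leftPt δ i)]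
    · linarith [dist_triangle z (hw.leftPt δ i) x]
  -- assemble, by cases on the direction of the outer crossing
  have key : ∀ dir : Bool, (dist (Γ a) x = if dir then q₁ else q₂) → (dist (Γ b) x = if dir then q₂ else q₁) →
      ∃ (a b : I) (dir : Bool) (m k₀ k₁ : ℕ),
      s ≤ a ∧ a < b ∧ b ≤ t ∧
      (∀ v, a ≤ v → v ≤ b → 0 < (v : ℝ) ∧ (v : ℝ) ≤ tailStart w.length) ∧
      (dist (Γ a) x = if dir then q₁ else q₂) ∧ (dist (Γ b) x = if dir then q₂ else q₁) ∧
      (∀ v, a < v → v < b → q₁ < dist (Γ v) x ∧ dist (Γ v) x < q₂) ∧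
      m < w.length ∧ pieceMid δ w m ∈ Γ '' {v | a ≤ v ∧ v ≤ b} ∧
      (q₁ < dist (pieceMid δ w m) x ∧ dist (pieceMid δ w m) x < q₂) ∧
      pieceMid δ w m ∈ closure (connectedComponentIn (U \ polyTrace δ w) (hw.leftPt δ m)) ∧
      k₀ ≤ k₁ ∧ k₁ < w.length ∧
      (∀ k, k₀ ≤ k → k ≤ k₁ → hw.leftPt δ k ∈ connectedComponentIn (U \ polyTrace δ w) (hw.leftPt δ m)) ∧
      (∀ k, k₀ ≤ k → k ≤ k₁ → dist (hw.leftPt δ k) x ≤ q₂ - 7 * δ) ∧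
      ((dist (hw.leftPt δ k₀) x ≤ q₁ + 9 * δ ∧ q₂ - 9 * δ ≤ dist (hw.leftPt δ k₁) x) ∨
        (q₂ - 9 * δ ≤ dist (hw.leftPt δ k₀) x ∧ dist (hw.leftPt δ k₁) x ≤ q₁ + 9 * δ)) := by
    intro dir ha hb
    refine ⟨a, b, dir, m, polyIdx w.length c, polyIdx w.length d, hsa, hab, hbt, htimes, ha, hb, hstrict, hn,
      ⟨u₁, ⟨hac.trans hcu₁, hu₁d.trans hdb⟩, hu₁⟩, hMdist,
      hw.pieceMid_mem_closure_connectedComponentIn hδ hn hballU, hk₀k₁, hk₁, hcomp, fun k hk1 hk2 ↦ ?_, ?_⟩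
    · linarith [(hchain k hk1 hk2).2]
    · rcases hends with ⟨h1, h2⟩ | ⟨h1, h2⟩
      · left; constructor <;> linarith
      · right; constructor <;> linarith
  rcases hlev with ⟨ha, hb⟩ | ⟨ha, hb⟩
  · exact key true (by simp [ha]) (by simp [hb])
  · exact key false (by simp [ha]) (by simp [hb])

/-! ### Many traversals force many disjoint open arms -/

omit hw hδ in
/-- Three pairwise distinct elements in a finset of cardinality `> 2`. [folklore] -/
theorem exists_three_of_two_lt_card {α : Type*} {s : Finset α} (h : 2 < s.card) :
    ∃ a ∈ s, ∃ b ∈ s, ∃ c ∈ s, a ≠ b ∧ a ≠ c ∧ b ≠ c :=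
  Finset.two_lt_card.1 h

/-- **Many traversals of a shell by an interface loop force many disjoint open arms** (the
deterministic core of Aizenman–Burchard 1999, App. A, for the loop ensemble with closed boundary
condition). If the polygon of the interface loop `w` of `ω` at mesh `δ` traverses `D(x; ρ, R)`
`2j + 3` times, and `0 < q₁`, `ρ ≤ q₁`, `q₁ + 40δ ≤ q₂ ≤ R`, then `ω` contains `j` pairwise
disjoint confined open arms across `A(x; q₁ + 9δ, q₂ - 9δ)`:
`ω ∈ (triArm δ x (q₁ + 9δ) (q₂ - 9δ))^{□ j}`. See the module docstring for the argument
(strict crossings are disjoint arcs; the components of the left hexagons of their middle darts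
are at most two-to-one by `not_three_arcs_touch`; the left chains are open arms, disjoint for
distinct components). [cite: AizenmanBurchardDuke1999, Appendix A] -/
theorem IsSiteInterfaceLoop.mem_disjointOccurrencePow_of_hasTraversals {x : ℂ} {ρ R q₁ q₂ : ℝ}
    (hq₁ : 0 < q₁) (hρq : ρ ≤ q₁) (hgap : q₁ + 40 * δ ≤ q₂) (hqR : q₂ ≤ R) {j : ℕ}
    (htr : (hexLoopCurve δ w).HasTraversals (2 * j + 3) x ρ R) :
    ω ∈ disjointOccurrencePow (triArm δ x (q₁ + 9 * δ) (q₂ - 9 * δ)) j := by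
  classical
  set Γ := hexLoopCurve δ w with hΓ
  set U : Set ℂ := {z | q₁ < dist z x ∧ dist z x < q₂} with hU
  have hq : q₁ < q₂ := by linarith
  have hlen : 0 < w.length := by have := hw.three_le_length; omega
  obtain ⟨s, t, htrav, hsep⟩ := htr.of_le (show 2 * j + 2 + 1 ≤ 2 * j + 3 by omega)
  have hs0 : ∀ l : Fin (2 * j + 2), 0 < (s l.succ : ℝ) := fun l ↦ by
    have h1 : t 0 < s l.succ := hsep (Fin.succ_pos l)
    have h1' : ((t 0 : I) : ℝ) < s l.succ := h1
    linarith [(t 0).2.1]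
  choose a b dir m k₀ k₁ hsa hab hbt htimes hA hB hstrict hmlt hMmem hMU hMcl hk₀k₁ hk₁ hcomp hconf hends using
    fun l : Fin (2 * j + 2) ↦ hw.exists_traversal_data hδ hρq hgap hqR (hs0 l) (htrav l.succ)
  /- the components of the left hexagons of the middle darts -/
  set comp : Fin (2 * j + 2) → Set ℂ := fun l ↦ connectedComponentIn (U \ polyTrace δ w) (hw.leftPt δ (m l))
    with hcompdef
  /- the arcs -/
  set arc : ∀ _ : Fin (2 * j + 2), Σ p : ℂ × ℂ, Path p.1 p.2 :=
    fun l ↦ orientedArc Γ (a l) (b l) (hab l).le (dir l) with harc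
  have harc1 : ∀ l, (arc l).1 = if dir l then (Γ (a l), Γ (b l)) else (Γ (b l), Γ (a l)) :=
    fun l ↦ orientedArc_fst Γ (hab l).le (dir l)
  have hrange : ∀ l, range (arc l).2 = Γ '' {v | a l ≤ v ∧ v ≤ b l} :=
    fun l ↦ range_orientedArc Γ (hab l).le (dir l)
  -- points of an arc: distances, and the only points on the circles
  have hpt : ∀ l (v : I), a l ≤ v → v ≤ b l →
      (dist (Γ v) x = q₁ → Γ v = (arc l).1.1) ∧ (dist (Γ v) x = q₂ → Γ v = (arc l).1.2) ∧
      q₁ ≤ dist (Γ v) x ∧ dist (Γ v) x ≤ q₂ := by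
    intro l v hav hvb
    have h1 := hA l; have h2 := hB l; have h3 := harc1 l
    cases hd : dir l
    · -- `dir = false`: `Γ a` on the outer circle, `Γ b` on the inner one
      simp only [hd, Bool.false_eq_true, ↓reduceIte] at h1 h2 h3
      rw [h3]
      rcases eq_or_lt_of_le hav with h | h
      · subst h; exact ⟨fun h' ↦ by rw [h1] at h'; linarith, fun _ ↦ rfl, by rw [h1]; exact hq.le, by rw [h1]⟩
      rcases eq_or_lt_of_le hvb with h' | h'
      · subst h'; exact ⟨fun _ ↦ rfl, fun h'' ↦ by rw [h2] at h''; linarith, by rw [h2], by rw [h2]; exact hq.le⟩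
      have := hstrict l v h h'
      exact ⟨fun h'' ↦ by linarith [this.1], fun h'' ↦ by linarith [this.2], this.1.le, this.2.le⟩
    · -- `dir = true`: `Γ a` on the inner circle, `Γ b` on the outer one
      simp only [hd, ↓reduceIte] at h1 h2 h3
      rw [h3]
      rcases eq_or_lt_of_le hav with h | h
      · subst h; exact ⟨fun _ ↦ rfl, fun h' ↦ by rw [h1] at h'; linarith, by rw [h1], by rw [h1]; exact hq.le⟩
      rcases eq_or_lt_of_le hvb with h' | h'
      · subst h'; exact ⟨fun h'' ↦ by rw [h2] at h''; linarith, fun _ ↦ rfl, by rw [h2]; exact hq.le, by rw [h2]⟩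
      have := hstrict l v h h'
      exact ⟨fun h'' ↦ by linarith [this.1], fun h'' ↦ by linarith [this.2], this.1.le, this.2.le⟩
  have he : ∀ l, dist (arc l).1.1 x = q₁ := by
    intro l; have h1 := hA l; have h2 := hB l; rw [harc1]
    cases hd : dir l
    · simp only [hd, Bool.false_eq_true, ↓reduceIte] at h1 h2 ⊢; exact h2
    · simp only [hd, ↓reduceIte] at h1 h2 ⊢; exact h1
  have hf : ∀ l, dist (arc l).1.2 x = q₂ := by
    intro l; have h1 := hA l; have h2 := hB l; rw [harc1]
    cases hd : dir l
    · simp only [hd, Bool.false_eq_true, ↓reduceIte] at h1 h2 ⊢; exact h1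
    · simp only [hd, ↓reduceIte] at h1 h2 ⊢; exact h2
  have hmemarc : ∀ l (u : I), ∃ v : I, a l ≤ v ∧ v ≤ b l ∧ (arc l).2 u = Γ v := by
    intro l u
    have : (arc l).2 u ∈ range (arc l).2 := ⟨u, rfl⟩
    rw [hrange] at this
    obtain ⟨v, ⟨h1, h2⟩, h3⟩ := this
    exact ⟨v, h1, h2, h3.symm⟩
  -- the arcs are pairwise disjoint (the polygon is simple, the time intervals are disjoint)
  have hinj := toCurve_injOn_of_isCycle hδ.ne' hw.isCycle
  have hdisj : ∀ l l', l ≠ l' → Disjoint (range (arc l).2) (range (arc l').2) := by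
    intro l l' hll'
    rw [hrange, hrange]
    refine disjoint_left.2 ?_
    rintro z ⟨v, ⟨hv1, hv2⟩, rfl⟩ ⟨v', ⟨hv1', hv2'⟩, hvv'⟩
    have heq : v = v' := (hinj (htimes l v hv1 hv2) (htimes l' v' hv1' hv2') hvv'.symm)
    subst heq
    rcases lt_or_gt_of_ne hll' with h | h
    · have h1 : t l.succ < s l'.succ := hsep (Fin.succ_lt_succ_iff.2 h)
      have := lt_of_le_of_lt ((hv2.trans (hbt l))) (h1.trans_le ((hsa l').trans hv1'))
      exact lt_irrefl _ this
    · have h1 : t l'.succ < s l.succ := hsep (Fin.succ_lt_succ_iff.2 h)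
      have := lt_of_le_of_lt ((hv2'.trans (hbt l'))) (h1.trans_le ((hsa l).trans hv1))
      exact lt_irrefl _ this
  -- the components miss the arcs
  have hcompsub : ∀ l, comp l ⊆ U \ polyTrace δ w := fun l ↦ connectedComponentIn_subset _ _
  have hST : ∀ l l', Disjoint (comp l) (range (arc l').2) := by
    intro l l'
    rw [hrange]
    refine disjoint_left.2 ?_
    rintro z hz ⟨v, -, rfl⟩
    exact (hcompsub l hz).2 (range_toCurve_subset_polyTrace hlen ⟨v, rfl⟩)
  /- no three components coincide -/
  have hfib : ∀ l₁ l₂ l₃ : Fin (2 * j + 2), l₁ ≠ l₂ → l₂ ≠ l₃ → l₃ ≠ l₁ →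
      comp l₁ = comp l₂ → comp l₂ = comp l₃ → False := by
    intro l₁ l₂ l₃ h12 h23 h31 e12 e23
    have htouch : ∀ l, comp l₁ = comp l → (closure (comp l₁) ∩ range (arc l).2 ∩ U).Nonempty := by
      intro l e
      refine ⟨pieceMid δ w (m l), ⟨?_, ?_⟩, hMU l⟩
      · rw [e]; exact hMcl l
      · rw [hrange]; exact hMmem l
    exact not_three_arcs_touch hq₁ hq (fun l ↦ (arc l).2) he hf
      (fun l u ↦ by obtain ⟨v, h1, h2, h3⟩ := hmemarc l u; rw [h3]; exact ⟨(hpt l v h1 h2).2.2.1, (hpt l v h1 h2).2.2.2⟩)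
      (fun l u hu ↦ by obtain ⟨v, h1, h2, h3⟩ := hmemarc l u; rw [h3] at hu ⊢; exact (hpt l v h1 h2).1 hu)
      (fun l u hu ↦ by obtain ⟨v, h1, h2, h3⟩ := hmemarc l u; rw [h3] at hu ⊢; exact (hpt l v h1 h2).2.1 hu)
      hdisj isPreconnected_connectedComponentIn (fun z hz ↦ (hcompsub l₁ hz).1) (hST l₁) h12 h23 h31
      (htouch l₁ rfl) (htouch l₂ e12) (htouch l₃ (e12.trans e23))
  /- counting: at least `j + 1` distinct components -/
  set F : Finset (Set ℂ) := Finset.univ.image comp with hF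
  have hcard : 2 * j + 2 ≤ 2 * F.card := by
    have h := Finset.card_le_mul_card_image (Finset.univ : Finset (Fin (2 * j + 2))) (f := comp) 2 ?_
    · simpa using h
    intro y hy
    by_contra hgt
    push Not at hgt
    obtain ⟨l₁, hl₁, l₂, hl₂, l₃, hl₃, h12, h13, h23⟩ := exists_three_of_two_lt_card hgt
    simp only [Finset.mem_filter, Finset.mem_univ, true_and] at hl₁ hl₂ hl₃
    exact hfib l₁ l₂ l₃ h12 h23 (Ne.symm h13) (hl₁.trans hl₂.symm) (hl₂.trans hl₃.symm)
  have hjF : j ≤ F.card := by omega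
  -- a section of `comp` over `F`, and `j` indices with pairwise distinct components
  have hsec : ∀ y : F, ∃ l, comp l = y := fun y ↦ by
    obtain ⟨l, -, hl⟩ := Finset.mem_image.1 y.2
    exact ⟨l, hl⟩
  choose sec hsec using hsec
  set L : Fin j → Fin (2 * j + 2) := fun i ↦ sec (F.equivFin.symm (Fin.castLE hjF i)) with hL
  have hLne : ∀ i i', i ≠ i' → comp (L i) ≠ comp (L i') := by
    intro i i' hii' h
    apply hii'
    have h1 : (F.equivFin.symm (Fin.castLE hjF i) : Set ℂ) = F.equivFin.symm (Fin.castLE hjF i') := by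
      rw [← hsec, ← hsec]; exact h
    have h2 := F.equivFin.symm.injective (Subtype.ext h1)
    exact Fin.castLE_injective hjF h2
  /- the chains -/
  refine mem_disjointOccurrencePow_triArm_of_chains (fun i ↦ k₁ (L i) - k₀ (L i))
    (fun i p ↦ hw.lv (k₀ (L i) + p)) (fun i p hp ↦ ?_) (fun i p hp ↦ ?_) (fun i p hp ↦ ?_) (fun i ↦ ?_) ?_
  · -- consecutive sites equal or adjacent
    have h := hw.lv_succ_eq_or_adj (i := k₀ (L i) + p) (by have := hk₁ (L i); omega)
    rcases h with h | h
    · exact Or.inl h.symm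
    · exact Or.inr h
  · -- confinement
    have := hconf (L i) (k₀ (L i) + p) (by omega) (by have := hk₀k₁ (L i); omega)
    change dist (hw.leftPt δ (k₀ (L i) + p)) x ≤ _
    linarith
  · -- openness
    exact hw.lv_mem (by have := hk₁ (L i); have := hk₀k₁ (L i); omega)
  · -- ends
    have e : k₀ (L i) + (k₁ (L i) - k₀ (L i)) = k₁ (L i) := by have := hk₀k₁ (L i); omega
    change (dist (hw.leftPt δ (k₀ (L i) + 0)) x ≤ _ ∧ _ ≤ dist (hw.leftPt δ (k₀ (L i) + (k₁ (L i) - k₀ (L i)))) x) ∨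
      (_ ≤ dist (hw.leftPt δ (k₀ (L i) + 0)) x ∧ dist (hw.leftPt δ (k₀ (L i) + (k₁ (L i) - k₀ (L i)))) x ≤ _)
    rw [add_zero, e]
    exact hends (L i)
  · -- disjointness from distinct components
    intro i i' hii' p p' hp hp' heq
    apply hLne i i' hii'
    have h1 := hcomp (L i) (k₀ (L i) + p) (by omega) (by have := hk₀k₁ (L i); omega)
    have h2 := hcomp (L i') (k₀ (L i') + p') (by omega) (by have := hk₀k₁ (L i'); omega)
    have hpt_eq : hw.leftPt δ (k₀ (L i) + p) = hw.leftPt δ (k₀ (L i') + p') := by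
      change triMeshPoint δ (hw.lv (k₀ (L i) + p)) = triMeshPoint δ (hw.lv (k₀ (L i') + p'))
      rw [heq]
    change connectedComponentIn (U \ polyTrace δ w) (hw.leftPt δ (m (L i))) =
      connectedComponentIn (U \ polyTrace δ w) (hw.leftPt δ (m (L i')))
    rw [connectedComponentIn_eq h1, connectedComponentIn_eq h2, hpt_eq]

end OneLoop

/-! ### The probabilistic estimate: hypothesis H1 for the loop ensemble -/

/-- Exponent algebra: `((c y)^α)^j = c^{α j} y^{α j}` for `c, y ≥ 0`. [folklore] -/
theorem rpow_pow_mul_eq {c y α : ℝ} (hc : 0 ≤ c) (hy : 0 ≤ y) (j : ℕ) :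
    ((c * y) ^ α) ^ j = c ^ (α * j) * y ^ (α * j) := by
  rw [← Real.rpow_natCast, ← Real.rpow_mul (mul_nonneg hc hy), Real.mul_rpow hc hy]

/-- **Hypothesis H1 of Aizenman–Burchard for the critical site-percolation loop ensemble with
closed boundary condition** (Duke Math. J. 99 (1999), eq. (1.3) and Appendix A: RSW for one
crossing, van den Berg–Kesten for `λ(k) → ∞`). There are a threshold `k`, a constant `K ≥ 0` and
an exponent `λ > 2` such that for every set `M` of sites (the sites kept; all others are closed),
every mesh `δ ∈ (0, 1]`, every centre `x` and all radii `δ ≤ ρ < R ≤ 1`, the `P_{1/2}`-probability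
that some interface loop of the restricted configuration `ω ∩ M` (a cycle of the hexagonal
lattice with open sites of `ω ∩ M` on its left and closed ones on its right), drawn at mesh `δ`,
traverses the shell `D(x; ρ, R)` by `k` separate segments is at most `K (ρ/R)^λ`. Proof: for
`R ≥ 4000ρ`, `mem_disjointOccurrencePow_of_hasTraversals` (with `q₁ = 1000ρ`, `q₂ = R`) puts
the event inside `j` disjoint occurrences of the increasing local event `triArm δ x (1000ρ + 9δ) (R - 9δ)`
for `ω` itself (`ω ∩ M ⊆ ω`), of probability `≤ ((1010ρ)/(R - 10δ))^{α j} ≤ (4000 ρ/R)^{α j}`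
by the iterated BK inequality and the annulus bound (`j = ⌈3/α⌉`, `λ = jα ≥ 3`); for
`R < 4000ρ` the bound `K (ρ/R)^λ ≥ 1` is trivial. [cite: AizenmanBurchardDuke1999, eq. (1.3) and Appendix A] -/
theorem triSitePercolation_exists_loop_hasTraversals_le :
    ∃ (k : ℕ) (K lam : ℝ), 0 ≤ K ∧ 2 < lam ∧
      ∀ (M : Set (Site 2)) (δ : ℝ), δ ∈ Set.Ioc (0 : ℝ) 1 → ∀ (x : ℂ) (ρ R : ℝ), δ ≤ ρ → ρ < R → R ≤ 1 →
        triSitePercolation half {ω | ∃ (f₀ : HexVertex) (w : hexGraph.Walk f₀ f₀),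
            IsSiteInterfaceLoop (ω ∩ M) w ∧ (hexLoopCurve δ w).HasTraversals k x ρ R} ≤
          ENNReal.ofReal (K * (ρ / R) ^ lam) := by
  obtain ⟨α, hα, hb⟩ := tri_annulusCrossing_bound_holds
  set j : ℕ := ⌈3 / α⌉₊ with hj
  have hjα : 3 ≤ α * j := by
    have : 3 / α ≤ j := Nat.le_ceil _
    rw [div_le_iff₀ hα] at this
    linarith
  set lam : ℝ := α * j with hlam
  have hlam2 : 2 < lam := by linarith
  have hlam0 : 0 ≤ lam := by linarith
  refine ⟨2 * j + 3, (4000 : ℝ) ^ lam, lam, by positivity, hlam2, ?_⟩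
  intro M δ hδ x ρ R hδρ hρR hR1
  obtain ⟨hδ0, hδ1⟩ := hδ
  have hρ : 0 < ρ := hδ0.trans_le hδρ
  have hR : 0 < R := hρ.trans hρR
  have hratio : 0 < ρ / R := div_pos hρ hR
  set E : Set (SiteConfig (Site 2)) := {ω | ∃ (f₀ : HexVertex) (w : hexGraph.Walk f₀ f₀),
    IsSiteInterfaceLoop (ω ∩ M) w ∧ (hexLoopCurve δ w).HasTraversals (2 * j + 3) x ρ R} with hE
  by_cases hbig : 4000 * ρ ≤ R
  · -- `j` disjoint arms across `A(x; 1000ρ + 9δ, R - 9δ)`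
    set r₁ : ℝ := 1000 * ρ + 9 * δ with hr₁
    set r₂ : ℝ := R - 9 * δ with hr₂
    have hsub : E ⊆ disjointOccurrencePow (triArm δ x r₁ r₂) j := by
      rintro ω ⟨f₀, w, hw, htr⟩
      have h := hw.mem_disjointOccurrencePow_of_hasTraversals hδ0 (q₁ := 1000 * ρ) (q₂ := R) (by positivity)
        (by linarith) (by linarith) le_rfl htr
      exact (isUpperSet_triArm δ x _ _).disjointOccurrencePow j Set.inter_subset_left h
    obtain ⟨F, hF⟩ := exists_finset_determinedBy_triArm hδ0 x r₁ r₂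
    -- one arm
    have h1 : 1000 * δ ≤ r₁ + δ := by rw [hr₁]; linarith
    have h2 : 2 * (r₁ + δ) ≤ r₂ - δ := by rw [hr₁, hr₂]; linarith
    have harm := real_triArm_le hb hδ0 x h1 h2
    have hθ0 : 0 ≤ (r₁ + δ) / (r₂ - δ) := div_nonneg (by rw [hr₁]; positivity) (by rw [hr₂]; linarith)
    have hθ : (r₁ + δ) / (r₂ - δ) ≤ 4000 * (ρ / R) := by
      rw [div_le_iff₀ (by rw [hr₂]; linarith), hr₁, hr₂]
      have : 4000 * (ρ / R) * (R - 9 * δ - δ) = 4000 * ρ - 40000 * (ρ / R) * δ := by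
        field_simp
        ring
      rw [this]
      have hρR' : ρ / R ≤ 1 / 4000 := by
        rw [div_le_div_iff₀ hR (by norm_num : (0 : ℝ) < 4000)]; linarith
      nlinarith
    have harm' : (triSitePercolation half).real (triArm δ x r₁ r₂) ≤ (4000 * (ρ / R)) ^ α :=
      harm.trans (Real.rpow_le_rpow hθ0 hθ hα.le)
    -- `j` disjoint arms
    have hpow := real_disjointOccurrencePow_le_pow (V := Site 2) half hF (isUpperSet_triArm δ x r₁ r₂) j
    have hreal : (triSitePercolation half).real (disjointOccurrencePow (triArm δ x r₁ r₂) j) ≤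
        (4000 : ℝ) ^ lam * (ρ / R) ^ lam := by
      refine (hpow.trans (pow_le_pow_left₀ measureReal_nonneg harm' j)).trans (le_of_eq ?_)
      rw [rpow_pow_mul_eq (by norm_num) hratio.le]
    calc triSitePercolation half E ≤ triSitePercolation half (disjointOccurrencePow (triArm δ x r₁ r₂) j) :=
          measure_mono hsub
      _ = ENNReal.ofReal ((triSitePercolation half).real (disjointOccurrencePow (triArm δ x r₁ r₂) j)) :=
          (ofReal_measureReal (measure_ne_top _ _)).symm
      _ ≤ ENNReal.ofReal ((4000 : ℝ) ^ lam * (ρ / R) ^ lam) := ENNReal.ofReal_le_ofReal hreal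
  · -- `R < 4000 ρ`: the bound is trivial
    push Not at hbig
    have hge : (1 : ℝ) ≤ (4000 : ℝ) ^ lam * (ρ / R) ^ lam := by
      rw [← Real.mul_rpow (by norm_num) hratio.le]
      refine Real.one_le_rpow ?_ hlam0
      rw [← mul_div_assoc, le_div_iff₀ hR]
      linarith
    calc triSitePercolation half E ≤ 1 := prob_le_one
      _ = ENNReal.ofReal 1 := ENNReal.ofReal_one.symm
      _ ≤ ENNReal.ofReal ((4000 : ℝ) ^ lam * (ρ / R) ^ lam) := ENNReal.ofReal_le_ofReal hge

end Literature.Probability.Percolation
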